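import Literature.Analysis.FluidPDE.OnsagerBDSVPerturbationFlowBounds
import HarnessLib

/-!
# The BDSV perturbation: Lemma 5.4, part II — `R̃_{q,i}` lies in the Mikado ball

Buckmaster–De Lellis–Székelyhidi–Vicol 2019, Lemma 5.4, last assertion: "for all `(x,t)`,
`R̃_{q,i}(x,t) ∈ B_{1/2}(Id) ⊂ 𝒮₊^{3×3}`", proved there from `‖∇Φᵢ - Id‖₀ ≲ ℓ^{2α}`,
`|η_i² R̊̄_q/ρ_{q,i}| ≲ |R̊̄_q|/δ_{q+1} ≲ ℓ^α` and `R̃_{q,i} - Id = ∇Φᵢ(R_{q,i}/ρ_{q,i} - Id)∇Φᵢᵀ + ∇Φᵢ∇Φᵢᵀ - Id`.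
For the construction of `OnsagerBDSVPerturbation.lean` (`BDSV.tildeR`, the (5.32) form, with the
Mikado ball `B̄_∞(Id, 1/10)` = `BDSV.mikadoRadius`) this file PROVES:

* `PerturbationHypotheses.abs_Rbar_le`: `|R̊̄_{lk}| ≤ C_in δ_{q+1} ℓ^α` read off (2.20)|_{N=0};
* `BDSV.abs_conj_sub_one_le`: the `3 × 3` algebra — entries of `(1+E)(1-N)(1+E)ᵀ - 1` are
  `≤ 15ε + η₀` when `|E| ≤ ε ≤ 1/10`, `|N| ≤ η₀ ≤ 1/10`;
* `BDSV.isSymm_tildeR`: `R̃_{q,i}` is symmetric (for symmetric `R̊̄_q`);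
* `PerturbationData.tildeR_mem_closedBall`: on `supp ηᵢ`, `R̃_{q,i}(x,t) ∈ B̄(Id, 1/10)` provided the
  deformation bound `exp(4C_inℓ^{2α}) - 1 ≤ 1/300` (part I), the stress bound `8C_in λ_q^α ℓ^α ≤ 1/100`
  and `4δ_{q+2} ≤ δ_{q+1}λ_q^{-α}` — three parameter inequalities valid for `a` large, the last two by
  `BDSV.exists_threshold_freq_mul_mollScale_rpow_le` (`λ_q ℓ ≤ λ_q^{-3α/2}`, proved here) and
  `BDSV.exists_threshold_four_amp`, the first by `BDSV.exists_threshold_mollScale_rpow_le` with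
  Mathlib's `Real.abs_exp_sub_one_le` (`|eˣ - 1| ≤ 2|x|` for `|x| ≤ 1`).

## References

* T. Buckmaster, C. De Lellis, L. Székelyhidi Jr., V. Vicol, *Onsager's conjecture for admissible
  weak solutions*, Comm. Pure Appl. Math. 72 (2019) = arXiv:1701.08678, Lemma 5.4 and its proof;
  §2.5 (2.20); §2.4 (definition of `ℓ`).
-/

open MeasureTheory Set
open scoped NNReal ENNReal ContDiff Matrix Matrix.Norms.Elementwise

noncomputable section

namespace Literature.Analysis.FluidPDE

namespace BDSV

open FunctionSpaces FunctionSpaces.Torus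

/-- The flat three-torus `T³ = (ℝ/ℤ)³`, local notation. -/
local notation "𝕋³" => UnitAddTorus (Fin 3)

/-- Euclidean `ℝ³`, local notation. -/
local notation "ℝ³" => EuclideanSpace ℝ (Fin 3)

/-! ## Lemma 5.4, part II: `R̃_{q,i}` lies in the Mikado ball and is symmetric -/

section TildeR

variable {P : Params} {S : Setting} {Nbar : ℕ} {Cin C₀ c₀ : ℝ} {Cη : ℕ → ℕ → ℝ}

/-- The pointwise stress bound extracted from (2.20)|_{N=0}: `|R̊̄_{lk}| ≤ C_in δ_{q+1} ℓ^α` on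
`[0,T] × T³` (for `C_in ≥ 0`, `a ≥ 1`). [cite: BuckmasterEtAl2018, §2.5 (2.20)] -/
theorem PerturbationHypotheses.abs_Rbar_le (H : PerturbationHypotheses P S Nbar Cin C₀) (hCin : 0 ≤ Cin)
    (ha : 1 ≤ P.a) {s : ℝ} (hs : s ∈ Icc 0 S.T) (x : 𝕋³) (l k : Fin 3) :
    |S.Rbar s x l k| ≤ Cin * (amp P.β P.a P.b (S.q + 1) * mollScale P.β P.α P.a P.b S.q ^ P.α) := by
  have hR := H.stress 0 (Nat.zero_le _) s hs
  simp only [Nat.cast_zero, neg_zero, zero_add] at hR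
  have hB : 0 ≤ Cin * (amp P.β P.a P.b (S.q + 1) * mollScale P.β P.α P.a P.b S.q ^ P.α) :=
    mul_nonneg hCin (mul_nonneg (amp_pos ha _).le (Real.rpow_nonneg (mollScale_pos ha _).le _))
  have h1 := norm_le_of_eContDiffHolderNorm_zero_le hB hR x
  have h2 : |S.Rbar s x l k| ≤ ‖S.Rbar s x l‖ := by
    rw [← Real.norm_eq_abs]; exact PiLp.norm_apply_le _ k
  exact (h2.trans (norm_le_pi_norm _ l)).trans h1

/-- **Matrix algebra of Lemma 5.4**: if `|E_{ab}| ≤ ε ≤ 1/10` and `|N_{ab}| ≤ η₀ ≤ 1/10`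
(`3 × 3` real matrices), then every entry of `(1 + E) (1 - N) (1 + E)ᵀ - 1` is at most `15ε + η₀` in
absolute value (`= -N + (1-N)Eᵀ + E(1-N)(1+E)ᵀ`). [cite: BuckmasterEtAl2018, Lemma 5.4 (proof, last display)] -/
theorem abs_conj_sub_one_le {E N : Matrix (Fin 3) (Fin 3) ℝ} {ε η₀ : ℝ} (hε : ∀ a b, |E a b| ≤ ε)
    (hε1 : ε ≤ 1 / 10) (hη : ∀ a b, |N a b| ≤ η₀) (hη1 : η₀ ≤ 1 / 10) (a b : Fin 3) :
    |((1 + E) * (1 - N) * (1 + E)ᵀ - 1 : Matrix (Fin 3) (Fin 3) ℝ) a b| ≤ 15 * ε + η₀ := by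
  have hε0 : 0 ≤ ε := (abs_nonneg _).trans (hε 0 0)
  have hη0 : 0 ≤ η₀ := (abs_nonneg _).trans (hη 0 0)
  -- entry bounds for `M = 1 - N` and `G = 1 + E`
  have hM : ∀ k l, |(1 - N : Matrix (Fin 3) (Fin 3) ℝ) k l| ≤ 11 / 10 := fun k l => by
    rw [Matrix.sub_apply, Matrix.one_apply]
    have h := hη k l
    split_ifs
    · calc |1 - N k l| ≤ |(1 : ℝ)| + |N k l| := abs_sub _ _
        _ ≤ 11 / 10 := by rw [abs_one]; linarith
    · rw [zero_sub, abs_neg]; linarith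
  have hG : ∀ k l, |((1 + E)ᵀ : Matrix (Fin 3) (Fin 3) ℝ) k l| ≤ 11 / 10 := fun k l => by
    rw [Matrix.transpose_apply, Matrix.add_apply, Matrix.one_apply]
    have h := hε l k
    split_ifs
    · calc |1 + E l k| ≤ |(1 : ℝ)| + |E l k| := abs_add_le _ _
        _ ≤ 11 / 10 := by rw [abs_one]; linarith
    · rw [zero_add]; linarith
  -- the decomposition `X - 1 = -N + (1 - N) Eᵀ + E (1 - N) (1 + E)ᵀ`
  have hdec : ((1 + E) * (1 - N) * (1 + E)ᵀ - 1 : Matrix (Fin 3) (Fin 3) ℝ) =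
      -N + (1 - N) * Eᵀ + E * (1 - N) * (1 + E)ᵀ := by
    rw [Matrix.transpose_add, Matrix.transpose_one]
    noncomm_ring
  rw [hdec, Matrix.add_apply, Matrix.add_apply, Matrix.neg_apply, Matrix.mul_apply, Matrix.mul_apply]
  have h1 : |∑ l, (1 - N : Matrix (Fin 3) (Fin 3) ℝ) a l * Eᵀ l b| ≤ 3 * (11 / 10 * ε) :=
    calc |∑ l, (1 - N : Matrix (Fin 3) (Fin 3) ℝ) a l * Eᵀ l b|
        ≤ ∑ l, |(1 - N : Matrix (Fin 3) (Fin 3) ℝ) a l * Eᵀ l b| := Finset.abs_sum_le_sum_abs _ _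
      _ ≤ ∑ _l : Fin 3, (11 / 10 * ε) := Finset.sum_le_sum fun l _ => by
          rw [abs_mul, Matrix.transpose_apply]
          exact mul_le_mul (hM a l) (hε b l) (abs_nonneg _) (by norm_num)
      _ = 3 * (11 / 10 * ε) := by simp
  have h2 : |∑ l, (E * (1 - N) : Matrix (Fin 3) (Fin 3) ℝ) a l * (1 + E)ᵀ l b| ≤
      3 * (3 * (ε * (11 / 10)) * (11 / 10)) :=
    calc |∑ l, (E * (1 - N) : Matrix (Fin 3) (Fin 3) ℝ) a l * (1 + E)ᵀ l b|
        ≤ ∑ l, |(E * (1 - N) : Matrix (Fin 3) (Fin 3) ℝ) a l * (1 + E)ᵀ l b| := Finset.abs_sum_le_sum_abs _ _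
      _ ≤ ∑ _l : Fin 3, (3 * (ε * (11 / 10)) * (11 / 10)) := Finset.sum_le_sum fun l _ => by
          rw [abs_mul]
          refine mul_le_mul ?_ (hG l b) (abs_nonneg _) (by positivity)
          rw [Matrix.mul_apply]
          calc |∑ k, E a k * (1 - N : Matrix (Fin 3) (Fin 3) ℝ) k l|
              ≤ ∑ k, |E a k * (1 - N : Matrix (Fin 3) (Fin 3) ℝ) k l| := Finset.abs_sum_le_sum_abs _ _
            _ ≤ ∑ _k : Fin 3, (ε * (11 / 10)) := Finset.sum_le_sum fun k _ => by
                rw [abs_mul]; exact mul_le_mul (hε a k) (hM k l) (abs_nonneg _) hε0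
            _ = 3 * (ε * (11 / 10)) := by simp
      _ = 3 * (3 * (ε * (11 / 10)) * (11 / 10)) := by simp
  calc |-N a b + ∑ l, (1 - N : Matrix (Fin 3) (Fin 3) ℝ) a l * Eᵀ l b +
        ∑ l, (E * (1 - N) : Matrix (Fin 3) (Fin 3) ℝ) a l * (1 + E)ᵀ l b|
      ≤ |-N a b + ∑ l, (1 - N : Matrix (Fin 3) (Fin 3) ℝ) a l * Eᵀ l b| +
        |∑ l, (E * (1 - N) : Matrix (Fin 3) (Fin 3) ℝ) a l * (1 + E)ᵀ l b| := abs_add_le _ _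
    _ ≤ (|-N a b| + |∑ l, (1 - N : Matrix (Fin 3) (Fin 3) ℝ) a l * Eᵀ l b|) +
        |∑ l, (E * (1 - N) : Matrix (Fin 3) (Fin 3) ℝ) a l * (1 + E)ᵀ l b| :=
          add_le_add (abs_add_le _ _) le_rfl
    _ ≤ (η₀ + 3 * (11 / 10 * ε)) + 3 * (3 * (ε * (11 / 10)) * (11 / 10)) := by
          rw [abs_neg]; exact add_le_add (add_le_add (hη a b) h1) h2
    _ ≤ 15 * ε + η₀ := by nlinarith

/-- `R̃_{q,i}` is symmetric (congruence of the symmetric `1 - c R̊̄` by `∇Φ_i`). [cite: BuckmasterEtAl2018, Lemma 5.4] -/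
theorem isSymm_tildeR {η : ℕ → ℝ → 𝕋³ → ℝ} {D : ℕ → ℝ → 𝕋³ → ℝ³} {t : ℝ} {x : 𝕋³}
    (hR : ∀ i j : Fin 3, S.Rbar t x i j = S.Rbar t x j i) (i : ℕ) : (tildeR P S η D i t x).IsSymm := by
  have hM : (1 - (etaMass P S η t / rhoQ P S t) • ofCols (S.Rbar t x) : Matrix (Fin 3) (Fin 3) ℝ).IsSymm := by
    refine Matrix.IsSymm.sub Matrix.isSymm_one (Matrix.IsSymm.smul ?_ _)
    ext a b
    simp [ofCols, hR a b]
  unfold tildeR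
  rw [Matrix.IsSymm, Matrix.transpose_mul, Matrix.transpose_mul, Matrix.transpose_transpose, hM.eq, Matrix.mul_assoc]

/-- **Lemma 5.4, last assertion**: at points of `supp ηᵢ`, if the deformation bound
`exp(4C_in ℓ^{2α}) - 1 ≤ 1/300`, the stress bound `8 C_in λ_q^α ℓ^α ≤ 1/100` and
`4δ_{q+2} ≤ δ_{q+1}λ_q^{-α}` hold (all true for `a` large), then `R̃_{q,i}(x,t)` lies in the closed
sup-ball of radius `1/10` about `Id` (`BDSV.mikadoRadius`; BDSV: `B_{1/2}(Id)`, from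
`|R̃_{q,i} - Id| ≲ ℓ^α`). [cite: BuckmasterEtAl2018, Lemma 5.4 (R̃_{q,i} ∈ B_{1/2}(Id))] -/
theorem PerturbationData.tildeR_mem_closedBall (H : PerturbationHypotheses P S Nbar Cin C₀)
    (𝒟 : PerturbationData P S c₀ Cη) (hCin : 0 ≤ Cin) (ha : 1 ≤ P.a)
    (hdef : Real.exp (4 * (Cin * mollScale P.β P.α P.a P.b S.q ^ (2 * P.α))) - 1 ≤ 1 / 300)
    (hstr : 8 * (Cin * (freq P.a P.b S.q ^ P.α * mollScale P.β P.α P.a P.b S.q ^ P.α)) ≤ 1 / 100)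
    (h4 : 4 * amp P.β P.a P.b (S.q + 2) ≤ amp P.β P.a P.b (S.q + 1) * freq P.a P.b S.q ^ (-P.α))
    {i : ℕ} {t : ℝ} (ht : t ∈ Icc 0 S.T) {x' : 𝕋³} (hη : 𝒟.cut.η i t x' ≠ 0) (x : 𝕋³) :
    tildeR P S 𝒟.cut.η 𝒟.D i t x ∈ Metric.closedBall (1 : Matrix (Fin 3) (Fin 3) ℝ) mikadoRadius := by
  -- the deformation `E = ∇D` and the normalised stress `N = (S/ρ) R̊̄`
  set E : Matrix (Fin 3) (Fin 3) ℝ := Matrix.of fun a b => partialDeriv b (𝒟.D i t) x a with hE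
  set N : Matrix (Fin 3) (Fin 3) ℝ := (etaMass P S 𝒟.cut.η t / rhoQ P S t) • ofCols (S.Rbar t x) with hN
  have hG : gradPhi 𝒟.D i t x = 1 + E := rfl
  have hε : ∀ a b, |E a b| ≤ 1 / 300 := fun a b => by
    rw [hE, Matrix.of_apply]
    exact (𝒟.abs_partialDeriv_D_le_of_eta_ne_zero H hCin ha ht hη x a b).trans hdef
  -- `ρ_q ≥ δλ^{-α}/8 > 0`, `S ≤ 1`
  have hδ : 0 < amp P.β P.a P.b (S.q + 1) := amp_pos ha _
  have hfr : 0 < freq P.a P.b S.q ^ (-P.α) := Real.rpow_pos_of_pos (freq_pos ha _) _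
  have hρ : amp P.β P.a P.b (S.q + 1) * freq P.a P.b S.q ^ (-P.α) / 8 ≤ rhoQ P S t := H.le_rhoQ h4 ht
  have hρ0 : 0 < rhoQ P S t := lt_of_lt_of_le (by positivity) hρ
  have hS1 : etaMass P S 𝒟.cut.η t ≤ 1 := 𝒟.etaMass_le_one ht
  have hS0 : 0 ≤ etaMass P S 𝒟.cut.η t :=
    Finset.sum_nonneg fun j _ => integral_nonneg fun y => sq_nonneg _
  have hc : etaMass P S 𝒟.cut.η t / rhoQ P S t ≤ 8 * freq P.a P.b S.q ^ P.α / amp P.β P.a P.b (S.q + 1) := by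
    rw [div_le_div_iff₀ hρ0 hδ]
    have h1 : etaMass P S 𝒟.cut.η t * amp P.β P.a P.b (S.q + 1) ≤ 1 * amp P.β P.a P.b (S.q + 1) :=
      mul_le_mul_of_nonneg_right hS1 hδ.le
    have h2 : 8 * freq P.a P.b S.q ^ P.α * (amp P.β P.a P.b (S.q + 1) * freq P.a P.b S.q ^ (-P.α) / 8) =
        amp P.β P.a P.b (S.q + 1) := by
      have : freq P.a P.b S.q ^ P.α * freq P.a P.b S.q ^ (-P.α) = 1 := by
        rw [← Real.rpow_add (freq_pos ha _), add_neg_cancel, Real.rpow_zero]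
      calc 8 * freq P.a P.b S.q ^ P.α * (amp P.β P.a P.b (S.q + 1) * freq P.a P.b S.q ^ (-P.α) / 8)
          = amp P.β P.a P.b (S.q + 1) * (freq P.a P.b S.q ^ P.α * freq P.a P.b S.q ^ (-P.α)) := by ring
        _ = _ := by rw [this, mul_one]
    calc etaMass P S 𝒟.cut.η t * amp P.β P.a P.b (S.q + 1) ≤ amp P.β P.a P.b (S.q + 1) := by linarith
      _ = 8 * freq P.a P.b S.q ^ P.α * (amp P.β P.a P.b (S.q + 1) * freq P.a P.b S.q ^ (-P.α) / 8) := h2.symm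
      _ ≤ 8 * freq P.a P.b S.q ^ P.α * rhoQ P S t :=
          mul_le_mul_of_nonneg_left hρ (mul_nonneg (by norm_num) (Real.rpow_nonneg (freq_pos ha _).le _))
  have hc0 : 0 ≤ etaMass P S 𝒟.cut.η t / rhoQ P S t := div_nonneg hS0 hρ0.le
  have hNb : ∀ a b, |N a b| ≤ 1 / 100 := fun a b => by
    rw [hN, Matrix.smul_apply, ofCols_apply, smul_eq_mul, abs_mul, abs_of_nonneg hc0]
    have hR := H.abs_Rbar_le hCin ha ht x b a
    calc etaMass P S 𝒟.cut.η t / rhoQ P S t * |S.Rbar t x b a|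
        ≤ (8 * freq P.a P.b S.q ^ P.α / amp P.β P.a P.b (S.q + 1)) *
            (Cin * (amp P.β P.a P.b (S.q + 1) * mollScale P.β P.α P.a P.b S.q ^ P.α)) :=
          mul_le_mul hc hR (abs_nonneg _)
            (div_nonneg (mul_nonneg (by norm_num) (Real.rpow_nonneg (freq_pos ha _).le _)) hδ.le)
      _ = 8 * (Cin * (freq P.a P.b S.q ^ P.α * mollScale P.β P.α P.a P.b S.q ^ P.α)) := by
          field_simp
      _ ≤ 1 / 100 := hstr
  have key := abs_conj_sub_one_le hε (by norm_num) hNb (by norm_num)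
  rw [Metric.mem_closedBall, dist_eq_norm]
  refine (pi_norm_le_iff_of_nonneg (by norm_num [mikadoRadius])).2 fun a =>
    (pi_norm_le_iff_of_nonneg (by norm_num [mikadoRadius])).2 fun b => ?_
  rw [Real.norm_eq_abs]
  have hx : (tildeR P S 𝒟.cut.η 𝒟.D i t x - 1) a b =
      ((1 + E) * (1 - N) * (1 + E)ᵀ - 1 : Matrix (Fin 3) (Fin 3) ℝ) a b := by
    rw [tildeR, hG]
  rw [hx]
  refine (key a b).trans ?_
  norm_num [mikadoRadius]


/-- **Smallness of `λ_q^α ℓ^α` for large `a`**: `ℓ λ_q ≤ λ_q^{-3α/2}` (since `δ_{q+1} ≤ δ_q`), so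
`C (λ_q ℓ)^α ≤ C λ_q^{-3α²/2} ≤ ε` for `a ≥ a₀(β, b, α, C, ε)`, all `q` (`0 < α`, `0 ≤ β`, `1 ≤ b`).
This is the parameter part of `|R̃_{q,i} - Id| ≲ ℓ^α` in Lemma 5.4. [cite: BuckmasterEtAl2018, Lemma 5.4 (proof)] -/
theorem exists_threshold_freq_mul_mollScale_rpow_le {β b α : ℝ} (hβ : 0 ≤ β) (hb : 1 ≤ b) (hα : 0 < α) (C : ℝ)
    {ε : ℝ} (hε : 0 < ε) :
    ∃ a₀ : ℝ, 1 < a₀ ∧ ∀ a : ℝ, a₀ ≤ a → ∀ q : ℕ,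
      C * (freq a b q ^ α * mollScale β α a b q ^ α) ≤ ε := by
  -- `λ ℓ ≤ λ^{-3α/2} ≤ a^{-3α/2}`, hence `(λℓ)^α ≤ a^{-(3α²/2)}`
  have key : ∀ a : ℝ, 1 ≤ a → ∀ q : ℕ, freq a b q ^ α * mollScale β α a b q ^ α ≤ a ^ (-(3 * α ^ 2 / 2)) := by
    intro a ha q
    have hf := freq_pos (b := b) ha q
    have hℓ := mollScale_pos (β := β) (α := α) (b := b) ha q
    have h1 : freq a b q * mollScale β α a b q ≤ freq a b q ^ (-(3 * α / 2)) := by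
      rw [mollScale]
      have hs : Real.sqrt (amp β a b (q + 1)) ≤ Real.sqrt (amp β a b q) := sqrt_amp_succ_le ha hb hβ q
      have hs0 : 0 < Real.sqrt (amp β a b q) := Real.sqrt_pos.2 (amp_pos ha q)
      calc freq a b q * (Real.sqrt (amp β a b (q + 1)) / (Real.sqrt (amp β a b q) * freq a b q ^ (1 + 3 * α / 2)))
          ≤ freq a b q * (Real.sqrt (amp β a b q) / (Real.sqrt (amp β a b q) * freq a b q ^ (1 + 3 * α / 2))) := by
            gcongr
        _ = freq a b q ^ (1 : ℝ) * freq a b q ^ (-(1 + 3 * α / 2)) := by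
            rw [Real.rpow_one, Real.rpow_neg hf.le]; field_simp
        _ = freq a b q ^ (-(3 * α / 2)) := by rw [← Real.rpow_add hf]; ring_nf
    have h2 : freq a b q ^ (-(3 * α / 2)) ≤ a ^ (-(3 * α / 2)) := by
      refine Real.rpow_le_rpow_of_nonpos (by linarith) ?_ (by nlinarith)
      calc a = 1 * a ^ (1 : ℝ) := by rw [one_mul, Real.rpow_one]
        _ ≤ 2 * Real.pi * a ^ (b ^ q) := by
            refine mul_le_mul (by linarith [Real.two_le_pi]) ?_ (by positivity) (by positivity)
            exact Real.rpow_le_rpow_of_exponent_le ha (one_le_pow₀ hb)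
        _ ≤ freq a b q := two_pi_mul_rpow_le_freq a b q
    calc freq a b q ^ α * mollScale β α a b q ^ α = (freq a b q * mollScale β α a b q) ^ α := by
          rw [Real.mul_rpow hf.le hℓ.le]
      _ ≤ (a ^ (-(3 * α / 2))) ^ α := Real.rpow_le_rpow (by positivity) (h1.trans h2) hα.le
      _ = a ^ (-(3 * α ^ 2 / 2)) := by rw [← Real.rpow_mul (by linarith)]; ring_nf
  rcases le_or_gt C 0 with hC | hC
  · refine ⟨2, one_lt_two, fun a ha q => ?_⟩
    have : 0 ≤ freq a b q ^ α * mollScale β α a b q ^ α :=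
      mul_nonneg (Real.rpow_nonneg (freq_pos (by linarith) q).le _) (Real.rpow_nonneg (mollScale_pos (by linarith) q).le _)
    nlinarith
  · set γ : ℝ := 3 * α ^ 2 / 2 with hγ
    have hγ0 : 0 < γ := by positivity
    have hεC : 0 < ε / C := div_pos hε hC
    refine ⟨max 2 ((ε / C) ^ (-(1 / γ))), lt_max_of_lt_left one_lt_two, fun a ha q => ?_⟩
    have ha1 : (1 : ℝ) ≤ a := by linarith [le_max_left (2 : ℝ) ((ε / C) ^ (-(1 / γ)))]
    have hpos : 0 < (ε / C) ^ (-(1 / γ)) := Real.rpow_pos_of_pos hεC _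
    have h3 : a ^ (-γ) ≤ ((ε / C) ^ (-(1 / γ))) ^ (-γ) :=
      Real.rpow_le_rpow_of_nonpos hpos (le_trans (le_max_right _ _) ha) (by linarith)
    have h4 : ((ε / C) ^ (-(1 / γ))) ^ (-γ) = ε / C := by
      rw [← Real.rpow_mul hεC.le, show (-(1 / γ)) * (-γ) = 1 by field_simp, Real.rpow_one]
    calc C * (freq a b q ^ α * mollScale β α a b q ^ α) ≤ C * a ^ (-γ) :=
          mul_le_mul_of_nonneg_left (key a ha1 q) hC.le
      _ ≤ C * (ε / C) := mul_le_mul_of_nonneg_left (h3.trans_eq h4) hC.le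
      _ = ε := by field_simp

end TildeR

end BDSV

end Literature.Analysis.FluidPDE
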